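import Literature.Computability.AlgebraicComplexity.VNPClosedUnderCoefficients
import Literature.Computability.AlgebraicComplexity.PermanentAsCoefficient
import Literature.Computability.AlgebraicComplexity.ValiantConjectureEquivProofs
import Summits.ValiantsHypothesis.Statement
import Summits.ValiantsHypothesis.ValiantsHypothesis.Theorems.CubeMultilinearisation
import HarnessLib

/-!
# Closure criteria for the collapse `VP = VNP`
## Boolean summation · Boolean-cube multilinearisation · coefficient extraction

Workshop `decomp-valiant`, lens 6 «restricted-models lifting axis», generation 20 — the KERNEL
CERTIFICATE behind calibration row C19-1 of the lineage's costume census (the «costume detector»).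
Nothing here proves `VP ≠ VNP`; rung currency: LADDER-Valiant rung 0.

### What is certified

Three operations generate `VNP` from `VP`: Valiant's Boolean (cube) summation `g ↦ Σ_{e ∈ {0,1}^u} g(X, e)`
(`boolSum`, the tree's definition of `VNP`), Boolean-cube MULTILINEARISATION
`g ↦ ML_E g = Σ_{b ∈ {0,1}^u} g(X, b) · δ_b(E)` (the polynomial multilinear in the block `E` agreeing with
`g` on `{0,1}^u`; `cubeML` of `Theorems/CubeMultilinearisation.lean`), and COEFFICIENT EXTRACTION
`g ↦ [Y^m] g` (`coeff m ∘ sumAlgEquiv`). For each, closure of `VP` under the operation — uniformly over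
all p-computable families — is EQUIVALENT to the collapse:

* `collapse_iff_closedUnderBoolSum` — every commutative semiring `k`:
  `VP k = VNP k ↔ ∀ g ∈ VP, (Σ_e g_n(X, e))_n ∈ VP`;
* `collapse_iff_closedUnderCubeML` — every commutative ring `k` in which `2` is a unit:
  `VP k = VNP k ↔ ∀ g ∈ VP, (ML_E g_n)_n ∈ VP`;
* `collapse_iff_closedUnderCoeff` — every field of characteristic `0`:
  `VP F = VNP F ↔ ∀ f ∈ VP, ∀ m, ([Y^{m_n}] f_n)_n ∈ VP`;

and the summit readings over `ℂ` (`Summits/ValiantsHypothesis/Statement.lean`: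
`ValiantsHypothesis = (VP ℂ ≠ VNP ℂ)`): `valiantsHypothesis_iff_not_closedUnderCubeML`,
`valiantsHypothesis_iff_not_closedUnderBoolSum`, `valiantsHypothesis_iff_not_closedUnderCoeff`,
`exists_vp_cubeML_not_vp_of_valiantsHypothesis`.

### Why the lineage wants it (piece tag COSTUME, evidence = these theorems)

A decomposition node on the lifting axis has the shape `Summit ⟸ (restricted lower bound, PROVED) ∧
(LIFTING LEMMA: restricted ⇒ general with stated loss)`. The census (HOME `census/COSTUME-CENSUS-v19.*`,
dials D1–D12; `decomp-val-lens-6/NODE-v10.md` §2) found that every UNIFORM lifting lemma along the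
multilinear axis — "multilinearisation / Boolean summation / coefficient extraction is cheap throughout
`VP`" — is not a piece strictly weaker than the summit but a statement of collapse strength. This file
makes the finding kernel-checked: each uniform closure statement is LITERALLY `VP = VNP` (`↔`), so as a
route piece it is COSTUME — asserting it asserts `¬ Summit`, asserting its failure asserts `Summit`
(`valiantsHypothesis_iff_not_closedUnder*`). Only NON-uniform liftings — one named family (`PER`, `IMM`)
or one restricted model (set-multilinear, non-commutative, monotone; the leaves (i)–(vi) of NODE-v10) —
escape the detector; those remain the live items of `Theses/DecompCycle1.lean` (`PerNotSmVP`;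
`TameOrSmLift`, declared residual) and `Theses/TameSensitivity.lean`.

### The mathematics (elementary; the point is the exact typing)

§0 bundles / unbundles families along `Fintype.equivFin` (`isVPFamily_of_collapse`,
`collapse_of_forall_isVPFamily`; tree: `mem_VNP_ofFintype_iff_holds`, `mem_VP_ofFintype_iff_holds`,
`VP_subset_VNP_holds`). §1 is the definition of `VNP` read both ways. §2: `ML_E g ∈ VNP` for `g ∈ VP`
over every commutative ring (`CubeMultilinearisation.isVNPFamily_cubeML`, explicit witness) gives `⇒`;
the HALF-POINT IDENTITY `Σ_e g(X, e) = 2^u · (ML_E g)(X, ½, …, ½)`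
(`CubeMultilinearisation.boolSum_eq_C_mul_aeval_cubeML` — the one place `2 ∈ kˣ` is used) and the
closure of `VP` under substitution and scalars (`IsVPFamily.aeval`, `IsVPFamily.C_mul`) give `⇐`.
§3 is assembled from the tree: `⇒` is Bürgisser's Prop. 3.1 (`isVNPFamily_coeff_of_isVPFamily`,
characteristic `0`), `⇐` is `PER_n = [Y_1 ⋯ Y_n] Π_i Σ_j x_{ij} Y_j` plus the `VNP`-completeness of `PER`
in characteristic `≠ 2` (`PermanentAsCoefficient.IsVNPFamily.isVPFamily_of_coeff_closed`). §4 reads the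
three criteria at `k = ℂ` against the summit statement.

Sources: Valiant 1979/1982 (p-definability via Boolean sums and via coefficients; completeness of the
permanent) [Valiant1979] [Valiant1982, §3]; Bürgisser 2000, Ch. 2 (Def. 2.2–2.6, the classes)
[Burgisser2000]; Bürgisser 2024, §3.1 and Prop. 3.1 (robustness; coefficients) [Burgisser2024Completeness];
the cube extension `Σ_b g(b) δ_b` is the standard arithmetisation object (e.g. [AaronsonWigderson2008, §4]).
Instrument data: HOME `census/COSTUME-CENSUS-v19.*`, `decomp-val-lens-6/NODE-v10.md`,
`decomp-val-lens-6/g19/NOTE-g19.md` §3 (row C19-1).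
-/

noncomputable section

open MvPolynomial Literature.Computability.AlgebraicComplexity
open Summit.ValiantsHypothesis.ValiantsHypothesis.Theorems.CubeMultilinearisation

set_option linter.dupNamespace false

namespace Summit.ValiantsHypothesis.ValiantsHypothesis.Theorems.ClosureCollapseCriteria

universe u v

/-! ## §0. Bundling bridge -/

section Bridge

variable {k : Type u} [CommSemiring k]

/-- Under `VP k = VNP k` every p-definable family over finite index types is p-computable
(bundle along `Fintype.equivFin`: `mem_VNP_ofFintype_iff_holds`, `mem_VP_ofFintype_iff_holds`). -/
theorem isVPFamily_of_collapse (h : VP k = VNP k) {σ : ℕ → Type v} [∀ n, Fintype (σ n)]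
    {f : ∀ n, MvPolynomial (σ n) k} (hf : IsVNPFamily f) : IsVPFamily f := by
  have hmem : PolyFamily.ofFintype f ∈ VNP k := (mem_VNP_ofFintype_iff_holds f).2 hf
  rw [← h] at hmem
  exact (mem_VP_ofFintype_iff_holds f).1 hmem

/-- Conversely, if every p-definable family `(f_n)`, `f_n ∈ k[X_0, …, X_{w(n)-1}]`, is
p-computable, then `VP k = VNP k` as sets of bundled families (`VP ⊆ VNP` is
`VP_subset_VNP_holds`). -/
theorem collapse_of_forall_isVPFamily
    (H : ∀ (w : ℕ → ℕ) (f : ∀ n, MvPolynomial (Fin (w n)) k), IsVNPFamily f → IsVPFamily f) :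
    VP k = VNP k :=
  Set.Subset.antisymm (VP_subset_VNP_holds k) fun F hF => H F.nvars F.poly hF

end Bridge

/-! ## §1. Criterion 1: closure under Boolean summation -/

section BoolSumClosure

variable {k : Type u} [CommSemiring k]

/-- The Boolean sum of a `VP` family is a `VNP` family (the definition of `VNP`, plus
`deg Σ_e g(X,e) ≤ deg g`). -/
theorem isVNPFamily_boolSum_of_isVPFamily {v u : ℕ → ℕ}
    {g : ∀ n, MvPolynomial (Fin (v n) ⊕ Fin (u n)) k} (hg : IsVPFamily g) :
    IsVNPFamily fun n => boolSum (g n) :=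
  ⟨⟨hg.1.1.mono fun n => by simp [Fintype.card_sum],
    hg.1.2.mono fun n => totalDegree_boolSum_le _⟩, u, g, hg, fun _ => rfl⟩

/-- `VP = VNP ⟹ VP` is closed under Boolean summation. -/
theorem closedUnderBoolSum_of_collapse (h : VP k = VNP k) {v u : ℕ → ℕ}
    {g : ∀ n, MvPolynomial (Fin (v n) ⊕ Fin (u n)) k} (hg : IsVPFamily g) :
    IsVPFamily fun n => boolSum (g n) :=
  isVPFamily_of_collapse h (isVNPFamily_boolSum_of_isVPFamily hg)

/-- `VP` closed under Boolean summation `⟹ VP = VNP`. -/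
theorem collapse_of_closedUnderBoolSum
    (H : ∀ (v u : ℕ → ℕ) (g : ∀ n, MvPolynomial (Fin (v n) ⊕ Fin (u n)) k),
      IsVPFamily g → IsVPFamily fun n => boolSum (g n)) :
    VP k = VNP k :=
  collapse_of_forall_isVPFamily fun w f hf => by
    obtain ⟨-, u, G, hG, hfG⟩ := hf
    rw [show f = fun n => boolSum (G n) from funext hfG]
    exact H w u G hG

/-- **Criterion 1.** `VP k = VNP k` iff `VP k` is closed under Valiant's Boolean summation:
for every p-computable `g_n ∈ k[X_0..X_{v(n)-1}, E_0..E_{u(n)-1}]` the family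
`(Σ_{e ∈ {0,1}^{u(n)}} g_n(X, e))_n` is p-computable. -/
theorem collapse_iff_closedUnderBoolSum :
    VP k = VNP k ↔ ∀ (v u : ℕ → ℕ) (g : ∀ n, MvPolynomial (Fin (v n) ⊕ Fin (u n)) k),
      IsVPFamily g → IsVPFamily fun n => boolSum (g n) :=
  ⟨fun h _ _ _ hg => closedUnderBoolSum_of_collapse h hg, collapse_of_closedUnderBoolSum⟩

end BoolSumClosure

/-! ## §2. Criterion 2: closure under cube multilinearisation (`2` a unit) -/

section CubeMLFamilies

variable {k : Type u} [CommRing k]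

/-- `VP = VNP ⟹` the cube multilinearisation of every `VP` family is `VP`. -/
theorem closedUnderCubeML_of_collapse (h : VP k = VNP k) {v u : ℕ → ℕ}
    {g : ∀ n, MvPolynomial (Fin (v n) ⊕ Fin (u n)) k} (hg : IsVPFamily g) :
    IsVPFamily fun n => cubeML (g n) :=
  isVPFamily_of_collapse h (isVNPFamily_cubeML hg)

/-- **The converse**: if `VP k` is closed under cube multilinearisation and `2` is a unit of `k`,
then `VP k = VNP k` — a p-definable `f_n = Σ_e G_n(X, e)` equals
`2^{u(n)} · (cubeML G_n)(X, ½, …, ½)` (`boolSum_eq_C_mul_aeval_cubeML`), one substitution and one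
scalar away from the `VP` family `cubeML G_n`. -/
theorem collapse_of_closedUnderCubeML (h2 : IsUnit (2 : k))
    (H : ∀ (v u : ℕ → ℕ) (g : ∀ n, MvPolynomial (Fin (v n) ⊕ Fin (u n)) k),
      IsVPFamily g → IsVPFamily fun n => cubeML (g n)) :
    VP k = VNP k := by
  obtain ⟨t, ht⟩ := h2.exists_left_inv
  refine collapse_of_forall_isVPFamily fun w f hf => ?_
  obtain ⟨hfP, u, G, hG, hfG⟩ := hf
  have hML := H w u G hG
  have hA : IsVPFamily fun n =>
      aeval (Sum.elim X (fun _ : Fin (u n) => C t) : Fin (w n) ⊕ Fin (u n) → MvPolynomial (Fin (w n)) k)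
        (cubeML (G n)) := by
    refine IsVPFamily.aeval hML _ hfP.1 ((IsPBounded.const 1).mono fun n => ?_)
      ((IsPBounded.const 0).mono fun n => le_of_eq ?_)
    · refine Finset.sup_le fun x _ => ?_
      rcases x with i | j
      · exact mvPolynomial_totalDegree_X_le_one _
      · simp
    · refine Finset.sum_eq_zero fun x _ => ?_
      rcases x with i | j
      · exact complexity_X_holds _
      · exact complexity_C_holds _
  have hB := hA.C_mul fun n => (2 : k) ^ u n
  rw [show f = fun n => C ((2 : k) ^ u n) *
      aeval (Sum.elim X (fun _ : Fin (u n) => C t)) (cubeML (G n)) from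
    funext fun n => (hfG n).trans (boolSum_eq_C_mul_aeval_cubeML t ht (G n))]
  exact hB

/-- **Criterion 2 (the costume detector).** If `2` is a unit of `k`: `VP k = VNP k` iff `VP k` is
closed under Boolean-cube multilinearisation — for every p-computable
`g_n ∈ k[X_0..X_{v(n)-1}, E_0..E_{u(n)-1}]`, the family `(cubeML g_n)_n` of the polynomials
multilinear in `E` agreeing with `g_n` on `{0,1}^{u(n)}` is p-computable. -/
theorem collapse_iff_closedUnderCubeML (h2 : IsUnit (2 : k)) :
    VP k = VNP k ↔ ∀ (v u : ℕ → ℕ) (g : ∀ n, MvPolynomial (Fin (v n) ⊕ Fin (u n)) k),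
      IsVPFamily g → IsVPFamily fun n => cubeML (g n) :=
  ⟨fun h _ _ _ hg => closedUnderCubeML_of_collapse h hg, collapse_of_closedUnderCubeML h2⟩

end CubeMLFamilies

/-! ## §3. Criterion 3: closure under coefficient extraction (characteristic zero) -/

section CoeffClosure

variable {F : Type u} [Field F] [CharZero F]

/-- `VP = VNP ⟹` coefficient families of `VP` families are `VP` (characteristic zero; the `VNP`
membership is Bürgisser's Prop. 3.1 as typed in the tree, `isVNPFamily_coeff_of_isVPFamily`). -/
theorem closedUnderCoeff_of_collapse (h : VP F = VNP F) (a : ℕ → ℕ) (τ : ℕ → Type)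
    [∀ n, Fintype (τ n)] [∀ n, DecidableEq (τ n)] (f : ∀ n, MvPolynomial (Fin (a n) ⊕ τ n) F)
    (m : ∀ n, Fin (a n) →₀ ℕ) (hf : IsVPFamily f) :
    IsVPFamily fun n => coeff (m n) (sumAlgEquiv F (Fin (a n)) (τ n) (f n)) :=
  isVPFamily_of_collapse h (isVNPFamily_coeff_of_isVPFamily hf m)

/-- **The converse** is the tree's `IsVNPFamily.isVPFamily_of_coeff_closed` (Bürgisser 2024, §3.1:
`PER_n = [Y_1 ⋯ Y_n] Π_i Σ_j x_{ij} Y_j` is a coefficient of a `VP` family, and `PER` is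
`VNP`-complete in characteristic `≠ 2`), bundled to the class equality. -/
theorem collapse_of_closedUnderCoeff
    (H : ∀ (a : ℕ → ℕ) (τ : ℕ → Type) [∀ n, Fintype (τ n)] [∀ n, DecidableEq (τ n)]
      (f : ∀ n, MvPolynomial (Fin (a n) ⊕ τ n) F) (m : ∀ n, Fin (a n) →₀ ℕ), IsVPFamily f →
      IsVPFamily fun n => coeff (m n) (sumAlgEquiv F (Fin (a n)) (τ n) (f n))) :
    VP F = VNP F :=
  collapse_of_forall_isVPFamily fun _ _ hf =>
    IsVNPFamily.isVPFamily_of_coeff_closed (by rw [ringChar.eq_zero]; decide) H hf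

/-- **Criterion 3.** Over a field of characteristic zero: `VP = VNP` iff `VP` is closed under
coefficient extraction — for every p-computable `f_n ∈ F[Y_0..Y_{a(n)-1}, X_τ]` and exponent vectors
`m_n ∈ ℕ^{a(n)}`, the family `([Y^{m_n}] f_n)_n ⊆ F[X_τ]` is p-computable (closure hypothesis in the
shape of `PermanentAsCoefficient.isVPFamily_perPoly_of_coeff_closed`). -/
theorem collapse_iff_closedUnderCoeff :
    VP F = VNP F ↔ ∀ (a : ℕ → ℕ) (τ : ℕ → Type) [∀ n, Fintype (τ n)] [∀ n, DecidableEq (τ n)]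
      (f : ∀ n, MvPolynomial (Fin (a n) ⊕ τ n) F) (m : ∀ n, Fin (a n) →₀ ℕ), IsVPFamily f →
      IsVPFamily fun n => coeff (m n) (sumAlgEquiv F (Fin (a n)) (τ n) (f n)) :=
  ⟨fun h a τ _ _ f m hf => closedUnderCoeff_of_collapse h a τ f m hf, collapse_of_closedUnderCoeff⟩

end CoeffClosure

/-! ## §4. The summit's reading -/

section Summit

/-- **Valiant's hypothesis ⟺ lossless multilinearisation fails somewhere inside `VP_ℂ`**:
`VP_ℂ ≠ VNP_ℂ` iff NOT every p-computable family has a p-computable cube multilinearisation. -/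
theorem valiantsHypothesis_iff_not_closedUnderCubeML :
    _root_.ValiantsHypothesis ↔ ¬ ∀ (v u : ℕ → ℕ) (g : ∀ n, MvPolynomial (Fin (v n) ⊕ Fin (u n)) ℂ),
      IsVPFamily g → IsVPFamily fun n => cubeML (g n) :=
  not_congr (collapse_iff_closedUnderCubeML (isUnit_iff_ne_zero.2 two_ne_zero))

/-- The same, unfolded: under Valiant's hypothesis there is a `VP_ℂ` family whose cube
multilinearisation is not in `VP_ℂ` — any "uniform lifting lemma" asserting that multilinearisation
is cheap throughout `VP_ℂ` is the negation of the summit. -/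
theorem exists_vp_cubeML_not_vp_of_valiantsHypothesis (h : _root_.ValiantsHypothesis) :
    ∃ (v u : ℕ → ℕ) (g : ∀ n, MvPolynomial (Fin (v n) ⊕ Fin (u n)) ℂ),
      IsVPFamily g ∧ ¬ IsVPFamily fun n => cubeML (g n) := by
  have h' := valiantsHypothesis_iff_not_closedUnderCubeML.1 h
  push Not at h'
  exact h'

/-- And Valiant's hypothesis in the Boolean-summation currency: `VP_ℂ ≠ VNP_ℂ` iff some p-computable
family has a Boolean sum outside `VP_ℂ`. -/
theorem valiantsHypothesis_iff_not_closedUnderBoolSum :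
    _root_.ValiantsHypothesis ↔ ¬ ∀ (v u : ℕ → ℕ) (g : ∀ n, MvPolynomial (Fin (v n) ⊕ Fin (u n)) ℂ),
      IsVPFamily g → IsVPFamily fun n => boolSum (g n) :=
  not_congr collapse_iff_closedUnderBoolSum

/-- And in the coefficient currency: `VP_ℂ ≠ VNP_ℂ` iff some p-computable family has a coefficient
family outside `VP_ℂ`. -/
theorem valiantsHypothesis_iff_not_closedUnderCoeff :
    _root_.ValiantsHypothesis ↔ ¬ ∀ (a : ℕ → ℕ) (τ : ℕ → Type) [∀ n, Fintype (τ n)]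
      [∀ n, DecidableEq (τ n)] (f : ∀ n, MvPolynomial (Fin (a n) ⊕ τ n) ℂ) (m : ∀ n, Fin (a n) →₀ ℕ),
      IsVPFamily f → IsVPFamily fun n => coeff (m n) (sumAlgEquiv ℂ (Fin (a n)) (τ n) (f n)) :=
  not_congr collapse_iff_closedUnderCoeff

end Summit

end Summit.ValiantsHypothesis.ValiantsHypothesis.Theorems.ClosureCollapseCriteria
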